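import Summits.Ventures.HSemireg.WedgeHankelRecurrenceHurwitzConvexParts

/-!
# Venture HSemireg — CONVEX COMBINATIONS IN THE COEFFICIENTS OF `p`: **if two real Hurwitz polynomials of the same degree `n` with positive leading coefficients have the same EVEN part
# (`a_{2j}` all equal, i.e. `contract₂ p₁ = contract₂ p₂`) or the same ODD part (`a_{2j+1}` all equal), then every convex combination `t p₁ + (1 − t) p₂`, `0 ≤ t ≤ 1`, is Hurwitz** — N259
# transported through the decomposition `p = (contract₂ p)(X²) + X·(contract₂ (p/X))(X²)` (N211)

HONEST FRAMING. Part of the Lean index of the computation cell `pub-hsemireg` (seat p10 gen 41, Sunday typer «UNIFORM-IN-n»).  Real polynomials only (N259 + N211 + N209 + N203's leading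
coefficients); no variety, no cohomology theory, no sheaf, no Ext group and no semiregularity map is constructed here; nothing here says that HC / HC_CM / HC_AV holds; no Literature fact
(unproved `Prop`) is declared or used.  Custodian versions as in `WedgeHankelSiegelIdeal` (1/3).
SOURCES (cited).  S. Białas, Bull. Polish Acad. Sci. Tech. Sci. 33 (1985) 473–480; S. P. Bhattacharyya, H. Chapellat, L. H. Keel, *Robust Control: The Parametric Approach* (1995), Ch. 2
(«segments of polynomials whose endpoints differ only in the even (odd) part are stable iff the endpoints are»).
DICTIONARY.  Hurwitz = all complex roots in `re < 0`; even part `contract 2 p` (`= Σ a_{2j} X^j`), odd part `contract 2 (p/X)` (`= Σ a_{2j+1} X^j`); `n = 2m + 2` or `2m + 3` for a common even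
part, `n = 2m + 3` or `2m + 4` for a common odd part.
DEDUP DISCLOSURE (`rg -n 'convex' Summits/Ventures/HSemireg`, 2026-09-02): N259 (split form).  The 6 names below: 0 hits tree-wide.

WHAT IS IN THE TREE.  N259 `forall_re_neg_convex_{odd_part_of_even, odd_part_of_odd, even_part_of_even, even_part_of_odd}`; N211 `eq_expand_contract_add_X_mul_expand_contract`,
`natDegree_parts_of_even ∕ _of_odd`; N203 `leadingCoeff_even_add_odd_of_even ∕ _of_odd`; N209 `coeff_pos_of_forall_re_neg`; Mathlib `Polynomial.coeff_contract`, `expand_C`.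
THIS FILE (namespace `Summit.Ventures.HSemireg.Wedge.HankelOuter` continued; CHAINED on N259; 0 definitions):
* §1028 `convex_expand_add_X_mul_expand_left ∕ _right` (the combination in split form), **`forall_re_neg_convex_of_contract_eq_of_even ∕ _of_odd`** (common even part, `n = 2m+2 ∕ 2m+3`),
  **`forall_re_neg_convex_of_contract_divX_eq_of_odd ∕ _of_even`** (common odd part, `n = 2m+3 ∕ 2m+4`).
CAVEATS.  Common odd part in degree `2` is not restated (positivity of three coefficients).  Nothing Ext-side.  New names only.
-/

open Module Polynomial
open scoped Matrix Polynomial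

namespace Summit.Ventures.HSemireg.Wedge.HankelOuter

/-! ## §1028. Segments with a common even or odd part, in the coefficients of `p` -/

/-- The convex combination of two split-form polynomials with the same even part. [bookkeeping; this file, §1028] -/
theorem convex_expand_add_X_mul_expand_left (f g₁ g₂ : ℝ[X]) (t : ℝ) :
    C t * (expand ℝ 2 f + Polynomial.X * expand ℝ 2 g₁) + C (1 - t) * (expand ℝ 2 f + Polynomial.X * expand ℝ 2 g₂)
      = expand ℝ 2 f + Polynomial.X * expand ℝ 2 (C t * g₁ + C (1 - t) * g₂) := by
  rw [map_add, map_mul, map_mul, expand_C, expand_C]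
  have hC : (C t + C (1 - t) : ℝ[X]) = 1 := by rw [← C_add, add_sub_cancel, C_1]
  linear_combination (expand ℝ 2 f) * hC

/-- The convex combination of two split-form polynomials with the same odd part. [bookkeeping; this file, §1028] -/
theorem convex_expand_add_X_mul_expand_right (f₁ f₂ g : ℝ[X]) (t : ℝ) :
    C t * (expand ℝ 2 f₁ + Polynomial.X * expand ℝ 2 g) + C (1 - t) * (expand ℝ 2 f₂ + Polynomial.X * expand ℝ 2 g)
      = expand ℝ 2 (C t * f₁ + C (1 - t) * f₂) + Polynomial.X * expand ℝ 2 g := by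
  rw [map_add, map_mul, map_mul, expand_C, expand_C]
  have hC : (C t + C (1 - t) : ℝ[X]) = 1 := by rw [← C_add, add_sub_cancel, C_1]
  linear_combination (Polynomial.X * expand ℝ 2 g) * hC

/-- **Common even part, even degree `n = 2m + 2`:** two Hurwitz polynomials of degree `n` with positive leading coefficients and `contract 2 p₁ = contract 2 p₂` span a Hurwitz segment.
[Białas 1985; Bhattacharyya–Chapellat–Keel Ch. 2; N259; this file, §1028] -/
theorem forall_re_neg_convex_of_contract_eq_of_even (m : ℕ) {p₁ p₂ : ℝ[X]} (h₁ : p₁.natDegree = 2 * m + 2) (h₂ : p₂.natDegree = 2 * m + 2) (hl₁ : 0 < p₁.leadingCoeff)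
    (heq : contract 2 p₁ = contract 2 p₂)
    (H₁ : ∀ z ∈ (p₁.map (algebraMap ℝ ℂ)).roots, z.re < 0) (H₂ : ∀ z ∈ (p₂.map (algebraMap ℝ ℂ)).roots, z.re < 0) {t : ℝ} (ht0 : 0 ≤ t) (ht1 : t ≤ 1) :
    ∀ z ∈ ((C t * p₁ + C (1 - t) * p₂).map (algebraMap ℝ ℂ)).roots, z.re < 0 := by
  have hp₁ := eq_expand_contract_add_X_mul_expand_contract p₁
  have hp₂ := eq_expand_contract_add_X_mul_expand_contract p₂
  rw [← heq] at hp₂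
  obtain ⟨hf, hg₁⟩ := natDegree_parts_of_even (m := m) (f := contract 2 p₁) (g := contract 2 p₁.divX) (by rw [← hp₁]; omega)
  obtain ⟨-, hg₂⟩ := natDegree_parts_of_even (m := m) (f := contract 2 p₁) (g := contract 2 p₂.divX) (by rw [← hp₂]; omega)
  have hlc : 0 < (contract 2 p₁).leadingCoeff := by
    rw [← leadingCoeff_even_add_odd_of_even (f := contract 2 p₁) (g := contract 2 p₁.divX) (by omega), ← hp₁]; exact hl₁
  rw [hp₁] at H₁
  rw [hp₂] at H₂
  rw [hp₁, hp₂, convex_expand_add_X_mul_expand_left]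
  exact forall_re_neg_convex_odd_part_of_even m hf hlc hg₁ hg₂ H₁ H₂ ht0 ht1

/-- **Common even part, odd degree `n = 2m + 3`.** [Białas 1985; Bhattacharyya–Chapellat–Keel Ch. 2; N259; this file, §1028] -/
theorem forall_re_neg_convex_of_contract_eq_of_odd (m : ℕ) {p₁ p₂ : ℝ[X]} (h₁ : p₁.natDegree = 2 * m + 3) (h₂ : p₂.natDegree = 2 * m + 3) (hl₁ : 0 < p₁.leadingCoeff)
    (heq : contract 2 p₁ = contract 2 p₂)
    (H₁ : ∀ z ∈ (p₁.map (algebraMap ℝ ℂ)).roots, z.re < 0) (H₂ : ∀ z ∈ (p₂.map (algebraMap ℝ ℂ)).roots, z.re < 0) {t : ℝ} (ht0 : 0 ≤ t) (ht1 : t ≤ 1) :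
    ∀ z ∈ ((C t * p₁ + C (1 - t) * p₂).map (algebraMap ℝ ℂ)).roots, z.re < 0 := by
  have hp₁ := eq_expand_contract_add_X_mul_expand_contract p₁
  have hp₂ := eq_expand_contract_add_X_mul_expand_contract p₂
  rw [← heq] at hp₂
  obtain ⟨hg₁, hf⟩ := natDegree_parts_of_odd (m := m + 1) (f := contract 2 p₁) (g := contract 2 p₁.divX) (by rw [← hp₁]; omega)
  obtain ⟨hg₂, -⟩ := natDegree_parts_of_odd (m := m + 1) (f := contract 2 p₁) (g := contract 2 p₂.divX) (by rw [← hp₂]; omega)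
  -- the common even part has full degree `m + 1` with positive leading coefficient (all coefficients of `p₁` are positive)
  have hcoef : 0 < (contract 2 p₁).coeff (m + 1) := by
    rw [coeff_contract two_ne_zero]
    exact coeff_pos_of_forall_re_neg hl₁ H₁ _ (by rw [h₁]; omega)
  have hfdeg : (contract 2 p₁).natDegree = m + 1 := le_antisymm hf (le_natDegree_of_ne_zero hcoef.ne')
  have hflc : 0 < (contract 2 p₁).leadingCoeff := by rw [leadingCoeff, hfdeg]; exact hcoef
  rw [hp₁] at H₁
  rw [hp₂] at H₂
  rw [hp₁, hp₂, convex_expand_add_X_mul_expand_left]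
  exact forall_re_neg_convex_odd_part_of_odd m hfdeg hflc hg₁ hg₂ H₁ H₂ ht0 ht1

/-- **Common odd part, odd degree `n = 2m + 3`:** `contract 2 (p₁/X) = contract 2 (p₂/X)`. [Białas 1985; Bhattacharyya–Chapellat–Keel Ch. 2; N259; this file, §1028] -/
theorem forall_re_neg_convex_of_contract_divX_eq_of_odd (m : ℕ) {p₁ p₂ : ℝ[X]} (h₁ : p₁.natDegree = 2 * m + 3) (h₂ : p₂.natDegree = 2 * m + 3) (hl₁ : 0 < p₁.leadingCoeff)
    (heq : contract 2 p₁.divX = contract 2 p₂.divX)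
    (H₁ : ∀ z ∈ (p₁.map (algebraMap ℝ ℂ)).roots, z.re < 0) (H₂ : ∀ z ∈ (p₂.map (algebraMap ℝ ℂ)).roots, z.re < 0) {t : ℝ} (ht0 : 0 ≤ t) (ht1 : t ≤ 1) :
    ∀ z ∈ ((C t * p₁ + C (1 - t) * p₂).map (algebraMap ℝ ℂ)).roots, z.re < 0 := by
  have hp₁ := eq_expand_contract_add_X_mul_expand_contract p₁
  have hp₂ := eq_expand_contract_add_X_mul_expand_contract p₂
  rw [← heq] at hp₂
  obtain ⟨hg, hf₁⟩ := natDegree_parts_of_odd (m := m + 1) (f := contract 2 p₁) (g := contract 2 p₁.divX) (by rw [← hp₁]; omega)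
  obtain ⟨-, hf₂⟩ := natDegree_parts_of_odd (m := m + 1) (f := contract 2 p₂) (g := contract 2 p₁.divX) (by rw [← hp₂]; omega)
  have hg0 : contract 2 p₁.divX ≠ 0 := by rintro h; rw [h, natDegree_zero] at hg; omega
  have hglc : 0 < (contract 2 p₁.divX).leadingCoeff := by
    rw [← leadingCoeff_even_add_odd_of_odd (f := contract 2 p₁) hg0 (by omega), ← hp₁]; exact hl₁
  rw [hp₁] at H₁
  rw [hp₂] at H₂
  rw [hp₁, hp₂, convex_expand_add_X_mul_expand_right]
  exact forall_re_neg_convex_even_part_of_odd m hg hglc hf₁ hf₂ H₁ H₂ ht0 ht1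

/-- **Common odd part, even degree `n = 2m + 4`:** `contract 2 (p₁/X) = contract 2 (p₂/X)`, both leading coefficients positive.
[Białas 1985; Bhattacharyya–Chapellat–Keel Ch. 2; N259; this file, §1028] -/
theorem forall_re_neg_convex_of_contract_divX_eq_of_even (m : ℕ) {p₁ p₂ : ℝ[X]} (h₁ : p₁.natDegree = 2 * m + 4) (h₂ : p₂.natDegree = 2 * m + 4) (hl₁ : 0 < p₁.leadingCoeff)
    (hl₂ : 0 < p₂.leadingCoeff) (heq : contract 2 p₁.divX = contract 2 p₂.divX)
    (H₁ : ∀ z ∈ (p₁.map (algebraMap ℝ ℂ)).roots, z.re < 0) (H₂ : ∀ z ∈ (p₂.map (algebraMap ℝ ℂ)).roots, z.re < 0) {t : ℝ} (ht0 : 0 ≤ t) (ht1 : t ≤ 1) :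
    ∀ z ∈ ((C t * p₁ + C (1 - t) * p₂).map (algebraMap ℝ ℂ)).roots, z.re < 0 := by
  have hp₁ := eq_expand_contract_add_X_mul_expand_contract p₁
  have hp₂ := eq_expand_contract_add_X_mul_expand_contract p₂
  rw [← heq] at hp₂
  obtain ⟨hf₁, hg⟩ := natDegree_parts_of_even (m := m + 1) (f := contract 2 p₁) (g := contract 2 p₁.divX) (by rw [← hp₁]; omega)
  obtain ⟨hf₂, -⟩ := natDegree_parts_of_even (m := m + 1) (f := contract 2 p₂) (g := contract 2 p₁.divX) (by rw [← hp₂]; omega)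
  have hflc₁ : 0 < (contract 2 p₁).leadingCoeff := by
    rw [← leadingCoeff_even_add_odd_of_even (f := contract 2 p₁) (g := contract 2 p₁.divX) (by omega), ← hp₁]; exact hl₁
  have hflc₂ : 0 < (contract 2 p₂).leadingCoeff := by
    rw [← leadingCoeff_even_add_odd_of_even (f := contract 2 p₂) (g := contract 2 p₁.divX) (by omega), ← hp₂]; exact hl₂
  rw [hp₁] at H₁
  rw [hp₂] at H₂
  rw [hp₁, hp₂, convex_expand_add_X_mul_expand_right]
  exact forall_re_neg_convex_even_part_of_even m hf₁ hflc₁ hf₂ hflc₂ hg H₁ H₂ ht0 ht1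

end Summit.Ventures.HSemireg.Wedge.HankelOuter
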